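import Mathlib
import HarnessLib
import Summits.AtomisticToContinuum.FouriersLaw.Theses.JunctionLocality
import Summits.AtomisticToContinuum.FouriersLaw.Theorems.JunctionLocalitySuperadditiveResistanceStubInsertionIdentity
import Summits.AtomisticToContinuum.FouriersLaw.Theorems.JunctionLocalitySuperadditiveResistanceKuboFrame
import Summits.AtomisticToContinuum.FouriersLaw.Theorems.JunctionLocalitySuperadditiveResistanceRoughnessSplit
import Summits.AtomisticToContinuum.FouriersLaw.Theorems.JunctionLocalitySuperadditiveResistanceTransferV4Nonneg

/-!
# Line `thermalise-then-cut-probe-insertion` — TRANSFER THEOREM of skeleton v4.3: the roughness bet is local Ohm + non-thermal pair roughness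
(crux `JunctionLocality.SuperadditiveResistance`, stmt-AtomisticToContinuum-11748; lead prover-line-stmt-AtomisticToContinuum-11748-c1-0, 2026-08-16)

The landed exact Hermite split (`helper_roughnessSplit`, p121758) reads, for the plain chain's first-order NESS density `h` and
`τ_s = ∫ h (p_s² − T) dμ_T` (first-order kinetic-temperature excesses of the pair), `k_s = p_s² − T`:
`v_K(h − θe_K) = (θ − (τ_{N−1}+τ_N)/2)²/T² + (τ_{N−1} − τ_N)²/(4T²) + [v_K(h) − (τ²_{N−1}+τ²_N)/(2T²)]` (the bracket `≥ 0`, `helper_roughnessBessel`).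
So v4.2's bet `∃ θ, v_K(h − θe_K) ≤ C₂G_L²` is EQUIVALENT to the conjunction of two named N-uniform statements about the PLAIN chain:
LOCAL OHM AT THE JUNCTION BOND `(τ_{N−1} − τ_N)² ≤ C G_L²` (one-bond first-order temperature drop `= O(current)`) and NON-THERMAL PAIR
ROUGHNESS `v_K(h) − (τ²_{N−1}+τ²_N)/(2T²) ≤ C G_L²` (beyond its two kinetic temperatures the pair is Maxwellian up to `O(current)` in `L²`).
`roughnessLTE_of_localOhm_nonThermal` is that implication (choose `θ = (τ_{N−1}+τ_N)/2`); `superadditiveResistance_of_lineBetsV43` composes it with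
the landed v4.2 transfer (p105987). No definitions, no named facts; standard axioms.
-/

noncomputable section

open MeasureTheory Filter Topology ProbabilityTheory
open scoped ContDiff NNReal
open Literature.MathematicalPhysics.KineticTheory.HeatConduction

namespace Summit.AtomisticToContinuum.FouriersLaw.Cruxes.SuperadditiveResistance.ThermaliseThenCutProbeInsertion

namespace TransferV43

/-- **v4.2's roughness bet from the two v4.3 bets** (local Ohm at the junction bond + non-thermal pair roughness), through the landed exact Hermite split
`helper_roughnessSplit` (p121758) at `θ = (τ_{N−1} + τ_N)/2`. -/
theorem roughnessLTE_of_localOhm_nonThermal :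
    (∀ (ω₂ lam β γ : ℝ) (μ : (N : ℕ) → ℝ → ℝ → Measure (PhaseSpace N)) (T : ℝ) (D : ℕ → ℝ),
      CruxFrame ω₂ lam β γ μ T D →
      ∃ C : ℝ, ∀ N M : ℕ, 2 ≤ N → 2 ≤ M →
        ∀ (h : PhaseSpace (N + M) → ℝ),
          PlainFrame (pinnedChain ω₂ lam β γ) T (N + M) h (D (N + M) / ((N : ℝ) + (M : ℝ) - 1)) →
          ((∫ x, h x * (kin (N + M) (N - 1) x - T) ∂((pinnedChain ω₂ lam β γ).gibbsMeasure (N + M) T)) -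
              (∫ x, h x * (kin (N + M) N x - T) ∂((pinnedChain ω₂ lam β γ).gibbsMeasure (N + M) T))) ^ 2 ≤
            C * (D (N + M) / ((N : ℝ) + (M : ℝ) - 1)) ^ 2) →
    (∀ (ω₂ lam β γ : ℝ) (μ : (N : ℕ) → ℝ → ℝ → Measure (PhaseSpace N)) (T : ℝ) (D : ℕ → ℝ),
      CruxFrame ω₂ lam β γ μ T D →
      ∃ C : ℝ, ∀ N M : ℕ, 2 ≤ N → 2 ≤ M →
        ∀ (h : PhaseSpace (N + M) → ℝ),
          PlainFrame (pinnedChain ω₂ lam β γ) T (N + M) h (D (N + M) / ((N : ℝ) + (M : ℝ) - 1)) →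
          roughness (pinnedChain ω₂ lam β γ) T N M h -
              ((∫ x, h x * (kin (N + M) (N - 1) x - T) ∂((pinnedChain ω₂ lam β γ).gibbsMeasure (N + M) T)) ^ 2 +
                (∫ x, h x * (kin (N + M) N x - T) ∂((pinnedChain ω₂ lam β γ).gibbsMeasure (N + M) T)) ^ 2) / (2 * T ^ 2) ≤
            C * (D (N + M) / ((N : ℝ) + (M : ℝ) - 1)) ^ 2) →
    ∀ (ω₂ lam β γ : ℝ) (μ : (N : ℕ) → ℝ → ℝ → Measure (PhaseSpace N)) (T : ℝ) (D : ℕ → ℝ),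
      CruxFrame ω₂ lam β γ μ T D →
      ∃ C₂ : ℝ, ∀ N M : ℕ, 2 ≤ N → 2 ≤ M →
        ∀ (h : PhaseSpace (N + M) → ℝ),
          PlainFrame (pinnedChain ω₂ lam β γ) T (N + M) h (D (N + M) / ((N : ℝ) + (M : ℝ) - 1)) →
          ∃ θ : ℝ, roughness (pinnedChain ω₂ lam β γ) T N M (fun x => h x - θ * eK T N M x) ≤
            C₂ * (D (N + M) / ((N : ℝ) + (M : ℝ) - 1)) ^ 2 := by
  intro hOhm hNT ω₂ lam β γ μ T D hF
  obtain ⟨Ca, hCa⟩ := hOhm ω₂ lam β γ μ T D hF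
  obtain ⟨Cb, hCb⟩ := hNT ω₂ lam β γ μ T D hF
  obtain ⟨hω, hl, hβ, hγ, -, -, hT, -, -⟩ := id hF
  refine ⟨Ca / (4 * T ^ 2) + Cb, fun N M hN hM h hPF => ?_⟩
  set τ₁ := ∫ x, h x * (kin (N + M) (N - 1) x - T) ∂((pinnedChain ω₂ lam β γ).gibbsMeasure (N + M) T) with hτ₁
  set τ₂ := ∫ x, h x * (kin (N + M) N x - T) ∂((pinnedChain ω₂ lam β γ).gibbsMeasure (N + M) T) with hτ₂
  refine ⟨(τ₁ + τ₂) / 2, ?_⟩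
  have hh : MemLp h 2 ((pinnedChain ω₂ lam β γ).gibbsMeasure (N + M) T) := hPF.1.1
  have hsplit := helper_roughnessSplit ω₂ lam β γ T hω hl.le hβ.le hT N M hN hM h hh ((τ₁ + τ₂) / 2)
  have ha := hCa N M hN hM h hPF
  have hb := hCb N M hN hM h hPF
  rw [hsplit]
  rw [← hτ₁, ← hτ₂] at ha hb ⊢
  have hT2 : 0 < 4 * T ^ 2 := by positivity
  have e1 : ((τ₁ + τ₂) / 2 - (τ₁ + τ₂) / 2) ^ 2 / T ^ 2 = 0 := by simp
  rw [e1, zero_add]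
  have h1 : (τ₁ - τ₂) ^ 2 / (4 * T ^ 2) ≤ Ca / (4 * T ^ 2) * (D (N + M) / ((N : ℝ) + (M : ℝ) - 1)) ^ 2 := by
    rw [div_mul_eq_mul_div, div_le_div_iff_of_pos_right hT2]
    exact ha
  linarith

/-- **TRANSFER THEOREM (skeleton v4.3).** The six open registered stubs — `stub_kuboFrame` (fixed-N), `stub_localOhmJunction`,
`stub_nonThermalPairRoughness`, `stub_junctionCurvature`, `stub_transferNonneg`, `stub_terminationLocalityTC`, `stub_farTransmission` — as hypotheses imply
the crux `JunctionLocality.SuperadditiveResistance` BY NAME: the two roughness halves give v4.2's `∃θ` roughness bet (`roughnessLTE_of_localOhm_nonThermal`) and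
the rest is the landed v4.2 transfer `TransferV4Nonneg.superadditiveResistance_of_lineBetsV4nonneg` (p105987). -/
theorem superadditiveResistance_of_lineBetsV43 :
    (∀ (ω₂ lam β γ T : ℝ), 0 < ω₂ → 0 < lam → 0 < β → 0 < γ → 0 < T →
        ∀ N M : ℕ, 2 ≤ N → 2 ≤ M →
          ∃ (g : Fin 4 → Fin 4 → ℝ) (gb₁ gb₄ : PhaseSpace (N + M) → ℝ),
            KuboFrame (pinnedChain ω₂ lam β γ) T N M g gb₁ gb₄) →
    (∀ (ω₂ lam β γ : ℝ) (μ : (N : ℕ) → ℝ → ℝ → Measure (PhaseSpace N)) (T : ℝ) (D : ℕ → ℝ),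
        CruxFrame ω₂ lam β γ μ T D →
        ∃ C : ℝ, ∀ N M : ℕ, 2 ≤ N → 2 ≤ M →
          ∀ (h : PhaseSpace (N + M) → ℝ),
            PlainFrame (pinnedChain ω₂ lam β γ) T (N + M) h (D (N + M) / ((N : ℝ) + (M : ℝ) - 1)) →
            ((∫ x, h x * (kin (N + M) (N - 1) x - T) ∂((pinnedChain ω₂ lam β γ).gibbsMeasure (N + M) T)) -
                (∫ x, h x * (kin (N + M) N x - T) ∂((pinnedChain ω₂ lam β γ).gibbsMeasure (N + M) T))) ^ 2 ≤
              C * (D (N + M) / ((N : ℝ) + (M : ℝ) - 1)) ^ 2) →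
    (∀ (ω₂ lam β γ : ℝ) (μ : (N : ℕ) → ℝ → ℝ → Measure (PhaseSpace N)) (T : ℝ) (D : ℕ → ℝ),
        CruxFrame ω₂ lam β γ μ T D →
        ∃ C : ℝ, ∀ N M : ℕ, 2 ≤ N → 2 ≤ M →
          ∀ (h : PhaseSpace (N + M) → ℝ),
            PlainFrame (pinnedChain ω₂ lam β γ) T (N + M) h (D (N + M) / ((N : ℝ) + (M : ℝ) - 1)) →
            roughness (pinnedChain ω₂ lam β γ) T N M h -
                ((∫ x, h x * (kin (N + M) (N - 1) x - T) ∂((pinnedChain ω₂ lam β γ).gibbsMeasure (N + M) T)) ^ 2 +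
                  (∫ x, h x * (kin (N + M) N x - T) ∂((pinnedChain ω₂ lam β γ).gibbsMeasure (N + M) T)) ^ 2) / (2 * T ^ 2) ≤
              C * (D (N + M) / ((N : ℝ) + (M : ℝ) - 1)) ^ 2) →
    (∀ (ω₂ lam β γ T : ℝ), 0 < ω₂ → 0 < lam → 0 < β → 0 < γ → 0 < T →
        ∃ C₃ : ℝ, ∀ N M : ℕ, 2 ≤ N → 2 ≤ M →
          ∀ (g : Fin 4 → Fin 4 → ℝ) (gb₁ gb₄ : PhaseSpace (N + M) → ℝ),
            KuboFrame (pinnedChain ω₂ lam β γ) T N M g gb₁ gb₄ →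
            curvature (pinnedChain ω₂ lam β γ) T N M gb₁ ≤ C₃ * selfLeft g ^ 2 ∧
            curvature (pinnedChain ω₂ lam β γ) T N M gb₄ ≤ C₃ * selfRight g ^ 2) →
    (∀ (ω₂ lam β γ T : ℝ), 0 < ω₂ → 0 < lam → 0 < β → 0 < γ → 0 < T →
        ∀ N M : ℕ, 2 ≤ N → 2 ≤ M →
          ∀ (g : Fin 4 → Fin 4 → ℝ) (gb₁ gb₄ : PhaseSpace (N + M) → ℝ),
            KuboFrame (pinnedChain ω₂ lam β γ) T N M g gb₁ gb₄ →
            0 ≤ transferLeft g ∧ 0 ≤ transferRight g) →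
    (∀ (ω₂ lam β γ : ℝ) (μ : (N : ℕ) → ℝ → ℝ → Measure (PhaseSpace N)) (T : ℝ) (D : ℕ → ℝ),
        CruxFrame ω₂ lam β γ μ T D →
        (∀ L : ℕ, 2 ≤ L → ∃ h : PhaseSpace L → ℝ,
            PlainFrame (pinnedChain ω₂ lam β γ) T L h (D L / ((L : ℝ) - 1))) →
        ∃ c : ℝ, ∀ N M : ℕ, 2 ≤ N → 2 ≤ M →
          ∀ (g : Fin 4 → Fin 4 → ℝ) (gb₁ gb₄ : PhaseSpace (N + M) → ℝ),
            KuboFrame (pinnedChain ω₂ lam β γ) T N M g gb₁ gb₄ →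
            selfLeft g ≤ D N / ((N : ℝ) - 1) * (1 + c * (D N / ((N : ℝ) - 1))) ∧
            selfRight g ≤ D M / ((M : ℝ) - 1) * (1 + c * (D M / ((M : ℝ) - 1)))) →
    (∀ (ω₂ lam β γ : ℝ) (μ : (N : ℕ) → ℝ → ℝ → Measure (PhaseSpace N)) (T : ℝ) (D : ℕ → ℝ),
        CruxFrame ω₂ lam β γ μ T D →
        (∀ L : ℕ, 2 ≤ L → ∃ h : PhaseSpace L → ℝ,
            PlainFrame (pinnedChain ω₂ lam β γ) T L h (D L / ((L : ℝ) - 1))) →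
        ∃ c : ℝ, ∀ N M : ℕ, 2 ≤ N → 2 ≤ M →
          ∀ (g : Fin 4 → Fin 4 → ℝ) (gb₁ gb₄ : PhaseSpace (N + M) → ℝ),
            KuboFrame (pinnedChain ω₂ lam β γ) T N M g gb₁ gb₄ →
            bypass g ≤ c * (D N / ((N : ℝ) - 1)) * (D M / ((M : ℝ) - 1))) →
    Summit.AtomisticToContinuum.FouriersLaw.Theses.JunctionLocality.SuperadditiveResistance := by
  intro hLRd hOhm hNT hCU hBD hTL hFT
  exact TransferV4Nonneg.superadditiveResistance_of_lineBetsV4nonneg hLRd (roughnessLTE_of_localOhm_nonThermal hOhm hNT) hCU hBD hTL hFT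

end TransferV43

end Summit.AtomisticToContinuum.FouriersLaw.Cruxes.SuperadditiveResistance.ThermaliseThenCutProbeInsertion

end
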